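/-
Copyright (c) 2026. All rights reserved.
Released under Apache 2.0 license as described in the file LICENSE.
Authors: abc-iut cell, prover seat abc-iut-L4-d2 (gen 9).
-/
import Literature.AnabelianGeometry.AbsoluteAnabelian.GaloisTheatersNumberFieldShadowTheaterHomFormula
import Literature.AnabelianGeometry.AbsoluteAnabelian.GaloisTheatersNumberFieldShadowTFPairsModel
import Literature.AnabelianGeometry.AbsoluteAnabelian.GaloisTheatersNumberFieldShadowTFPairsCor52iii
import Literature.AnabelianGeometry.AbsoluteAnabelian.GaloisTheatersNumberFieldShadowPanalocalHom
import Literature.AnabelianGeometry.AbsoluteAnabelian.PanalocalTPairs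
import HarnessLib

/-!
# [AbsTopIII] Def 5.1 (vi) / Cor 5.2 (vi), morphism part (F-3086 `PanalocalTPairMapsHom`) PROVED at the `TF`-shadow
# vocabularies over the number-field shadow context

S. Mochizuki, *Topics in absolute anabelian geometry III* [MochizukiAbsTopIII2015], Def 5.1 (vi) p. 118 ("we obtain a natural
“panalocalization functor” `Th⊚_T → Th✠_T`"), Cor 5.2 (vi) p. 120 (the functors `EA⊚ → An⊚[Th✠_T] → Th✠_T`, the second "forgetting
the way in which the data arose from `Π`" — gloss), Def 5.1 (iv) p. 116 (morphisms of panalocal Galois-theaters).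

The cell typed the morphism part of the panalocalization of `T`-pairs as the named fact `PanalocalTPairMapsHom W` (F-3086,
`PanalocalTPairs.lean`, abc-iut-L4-t3; WEAK form: a morphism of global `T`-pairs induces SOME morphism between any
panalocalizations).  THIS PROOF-ONLY FILE proves it over `NumberFieldShadow.context F` at every `TF`-shadow vocabulary
`{ fieldShadowVocabulary F with IsMLFGaloisPair := P, IsAutHolPair := P' }` — the construction reads NEITHER local-pair predicate —
(corollaries at `fieldShadowVocabulary F`, `fieldShadowVocabulary' F`).
Construction of `{φ}✠ : {M⊚₁}✠ → {M⊚₂}✠` from `φ : M⊚₁ → M⊚₂`: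

* on the underlying sets, `V⊚(φ_Π)` DESCENDS along the reference bijections `ψ₁, ψ₂` to `V✠₁ ≅ V✠₂` (abc-iut-L4-d2 g6,
  `exists_modAut_equiv`: translation by `τ_{φ_Π}` carries `Aut(Π₁)`-classes to `Aut(Π₂)`-classes) — `exists_classEquiv`;
* at a nonarchimedean class `c` with chosen lift `ṽ`, the local `T`-pair of `{M⊚₁}✠` is identified with `((Π₁)_ṽ ↷ (M₁)_ṽ)`
  (panalocalization relation), `φ_ṽ` carries it to `((Π₂)_{φ_V ṽ} ↷ (M₂)_{φ_V ṽ})`, and `φ_V(ψ_{V,1} ṽ) = ψ_{V,2}(V⊚(φ_Π) ṽ)`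
  (`theaterHom_phiV_apply_eq`, Rmk 5.1.1) says this IS the local pair of `M⊚₂` at a lift of the image class, identified with the
  local pair of `{M⊚₂}✠` there; the open injection of groups is `(Π₁)_ṽ ↪ (Π₂)_{φ_V ṽ}` conjugated by these identifications
  (`GlobalGaloisTheater.Hom.exists_decompGrpHom`, `IsOpenInjection.equiv_comp_comp_equiv`), the `T`-isomorphism the composite of
  the three (`Iso.conj₃_comm`); archimedean classes likewise with Kummer structures (`kummerTransportTF_conj₃`).

HONEST LABEL: shadow (`Δ = 1`), algebraic parts of the completions, STUB Aut-holomorphic orbispaces (free `fieldIso`, G1/T2);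
WEAK form as typed (existence of a morphism, no functoriality claim); NOT the genuine `(R, W)` (E-L4-13).  No
`def`/`instance`/`structure`; nothing here bears on [IUTchIII] Cor. 3.12 or takes a side; typed ≠ proved.
-/

noncomputable section

open scoped Pointwise Topology
open CategoryTheory NumberField Field

namespace Literature.AnabelianGeometry.AbsoluteAnabelian

universe u

/-! ### Generic bookkeeping (any context, any vocabulary) -/

section Generic

variable {R : GlobalAnabelianContext.{u}} {T : TKind} {W : TPairVocabulary R T}

/-- The nonarchimedean clause of the panalocalization relation, read at a PRESCRIBED point `b = ψ_V(u)` and class `c = ψ[u]`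
(bookkeeping: transport along the two equations). [cite: MochizukiAbsTopIII2015, Def 5.1 (vi) p.118] -/
theorem PanalocalTPair.nonarch_at (Q : PanalocalTPair W) (M : GlobalTPair W)
    (ψV : (R.proVal M.theater.ext).carrier ≃ₜ M.theater.V.carrier) (ψ : R.ProValModAut M.theater.ext ≃ Q.theater.V)
    (hN : ∀ (vl : (R.proVal M.theater.ext).carrier) (hvl : ψV vl ∈ M.theater.V.non)
        (hc : ψ (R.toModAut M.theater.ext vl) ∈ Q.theater.non),
      ∃ (e : M.theater.V.decompGrp (ψV vl) ≃ₜ* Q.theater.grp ⟨_, hc⟩)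
        (φ : M.Mnon ⟨ψV vl, hvl⟩ ≅ Q.data.Mnon ⟨_, hc⟩),
        ∀ g, (M.actNon ⟨ψV vl, hvl⟩ g).hom ≫ φ.hom = φ.hom ≫ (Q.data.actNon ⟨_, hc⟩ (e g)).hom)
    (u : (R.proVal M.theater.ext).carrier) (b : M.theater.V.carrier) (hb : b ∈ M.theater.V.non) (hub : ψV u = b)
    (c : Q.theater.V) (hc : c ∈ Q.theater.non) (huc : ψ (R.toModAut M.theater.ext u) = c) :
    ∃ (e : M.theater.V.decompGrp b ≃ₜ* Q.theater.grp ⟨c, hc⟩) (φ : M.Mnon ⟨b, hb⟩ ≅ Q.data.Mnon ⟨c, hc⟩),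
      ∀ g, (M.actNon ⟨b, hb⟩ g).hom ≫ φ.hom = φ.hom ≫ (Q.data.actNon ⟨c, hc⟩ (e g)).hom := by
  subst hub
  subst huc
  exact hN u hb hc

/-- The archimedean clause of the panalocalization relation at a prescribed point and class.
[cite: MochizukiAbsTopIII2015, Def 5.1 (vi) p.118] -/
theorem PanalocalTPair.arch_at (Q : PanalocalTPair W) (M : GlobalTPair W)
    (ψV : (R.proVal M.theater.ext).carrier ≃ₜ M.theater.V.carrier) (ψ : R.ProValModAut M.theater.ext ≃ Q.theater.V)
    (hA : ∀ (vl : (R.proVal M.theater.ext).carrier) (hvl : ψV vl ∈ M.theater.V.arc)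
        (hc : ψ (R.toModAut M.theater.ext vl) ∈ Q.theater.arc),
      ∃ (x : AutHolOrbispace.Iso (M.theater.X ⟨ψV vl, hvl⟩) (Q.theater.X ⟨_, hc⟩))
        (φ : M.Marc ⟨ψV vl, hvl⟩ ≅ Q.data.Marc ⟨_, hc⟩),
        W.kummerTransport x φ (M.kummer ⟨ψV vl, hvl⟩) = Q.data.kummer ⟨_, hc⟩)
    (u : (R.proVal M.theater.ext).carrier) (b : M.theater.V.carrier) (hb : b ∈ M.theater.V.arc) (hub : ψV u = b)
    (c : Q.theater.V) (hc : c ∈ Q.theater.arc) (huc : ψ (R.toModAut M.theater.ext u) = c) :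
    ∃ (x : AutHolOrbispace.Iso (M.theater.X ⟨b, hb⟩) (Q.theater.X ⟨c, hc⟩)) (φ : M.Marc ⟨b, hb⟩ ≅ Q.data.Marc ⟨c, hc⟩),
      W.kummerTransport x φ (M.kummer ⟨b, hb⟩) = Q.data.kummer ⟨c, hc⟩ := by
  subst hub
  subst huc
  exact hA u hb hc

/-- **"`φ_Π` induces an open injection `Π_{v₁} ↪ Π_{v₂}`"** (Def 5.1 (iii) (a)) for a morphism of global Galois-theaters, as a
continuous homomorphism of the decomposition groups with its defining formula. [cite: MochizukiAbsTopIII2015, Def 5.1 (iii) p.116] -/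
theorem GlobalGaloisTheater.Hom.exists_decompGrpHom {T₁ T₂ : GlobalGaloisTheater R} (φ : GlobalGaloisTheater.Hom T₁ T₂)
    (a : T₁.V.carrier) :
    ∃ r : T₁.V.decompGrp a →ₜ* T₂.V.decompGrp (φ.φV a), IsOpenInjection r ∧ ∀ g, (r g).1 = φ.φgrp.arith g.1 := by
  have hmem : ∀ g : T₁.ext.arith, g ∈ T₁.V.decomp a ↔ φ.φgrp.arith g ∈ T₂.V.decomp (φ.φV a) := by
    intro g
    simp only [GaloisProSet.decomp, MulAction.mem_stabilizer_iff, ← φ.φV_smul]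
    exact φ.φV.injective.eq_iff.symm
  refine ⟨{ toFun := fun g => ⟨φ.φgrp.arith g.1, (hmem g.1).mp g.2⟩
            map_one' := Subtype.ext (map_one φ.φgrp.arith)
            map_mul' := fun x y => Subtype.ext (map_mul φ.φgrp.arith x.1 y.1)
            continuous_toFun := (φ.φgrp.arith.continuous.comp continuous_subtype_val).subtype_mk _ },
    ⟨fun x y h => Subtype.ext (φ.isEAHom.injective (congrArg Subtype.val h)), ?_⟩, fun _ => rfl⟩
  have hrange : Set.range (fun g : T₁.V.decompGrp a =>
      (⟨φ.φgrp.arith g.1, (hmem g.1).mp g.2⟩ : T₂.V.decompGrp (φ.φV a))) = Subtype.val ⁻¹' Set.range φ.φgrp.arith := by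
    ext h
    constructor
    · rintro ⟨g, rfl⟩
      exact ⟨g.1, rfl⟩
    · rintro ⟨g, hg⟩
      have hg' : g ∈ T₁.V.decomp a := (hmem g).mpr (hg ▸ h.2)
      exact ⟨⟨g, hg'⟩, Subtype.ext hg⟩
  change IsOpen (Set.range fun g : T₁.V.decompGrp a =>
    (⟨φ.φgrp.arith g.1, (hmem g.1).mp g.2⟩ : T₂.V.decompGrp (φ.φV a)))
  rw [hrange]
  exact φ.isEAHom.isOpen_range.preimage continuous_subtype_val

/-- An open injection of profinite groups conjugated by isomorphisms of profinite groups is an open injection ("`Orb(TG)`":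
open injections considered up to isomorphism). [cite: MochizukiAbsTopIII2015, Def 5.1 (iv) p.116] -/
theorem IsOpenInjection.equiv_comp_comp_equiv {A B C D : ProfiniteGrp.{u}} (e₁ : B ≃ₜ* A) (r : B →ₜ* C)
    (hr : IsOpenInjection r) (e₂ : C ≃ₜ* D) :
    IsOpenInjection ((e₂ : C →ₜ* D).comp (r.comp (e₁.symm : A →ₜ* B))) := by
  refine ⟨e₂.injective.comp (hr.injective.comp e₁.symm.injective), ?_⟩
  have hr' : Set.range ((e₂ : C →ₜ* D).comp (r.comp (e₁.symm : A →ₜ* B))) = e₂ '' Set.range r := by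
    ext d
    constructor
    · rintro ⟨a, rfl⟩
      exact ⟨r (e₁.symm a), ⟨e₁.symm a, rfl⟩, rfl⟩
    · rintro ⟨_, ⟨b, rfl⟩, rfl⟩
      refine ⟨e₁ b, ?_⟩
      change e₂ (r (e₁.symm (e₁ b))) = e₂ (r b)
      rw [ContinuousMulEquiv.symm_apply_apply]
  rw [hr']
  exact e₂.toHomeomorph.isOpenMap _ hr.isOpen_range

/-- **Three compatible squares compose**: if `a' g` is intertwined with `a g` by `φ₁`, with `b' g` by `ψ`, and `b' g` with
`b g` by `φ₂`, then `a g` is intertwined with `b g` by `φ₁⁻¹ ≫ ψ ≫ φ₂` (the `T`-isomorphism of `{φ}✠` at a class).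
[cite: MochizukiAbsTopIII2015, Def 5.1 (vi) p.118] -/
theorem Iso.conj₃_comm {C : Type*} [Category C] {A' A B' B : C} (φ₁ : A' ≅ A) (ψ : A' ≅ B') (φ₂ : B' ≅ B)
    {ag : A ⟶ A} {a'g : A' ⟶ A'} {b'g : B' ⟶ B'} {bg : B ⟶ B}
    (h1 : a'g ≫ φ₁.hom = φ₁.hom ≫ ag) (h2 : a'g ≫ ψ.hom = ψ.hom ≫ b'g) (h3 : b'g ≫ φ₂.hom = φ₂.hom ≫ bg) :
    ag ≫ (φ₁.symm ≪≫ ψ ≪≫ φ₂).hom = (φ₁.symm ≪≫ ψ ≪≫ φ₂).hom ≫ bg := by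
  have h1' : ag ≫ φ₁.inv = φ₁.inv ≫ a'g := by
    rw [Iso.comp_inv_eq, Category.assoc, Iso.eq_inv_comp, h1]
  simp only [Iso.trans_hom, Iso.symm_hom]
  rw [← Category.assoc ag, h1', Category.assoc, ← Category.assoc a'g, h2, Category.assoc, h3]
  simp only [Category.assoc]

/-- `Iso.conj₃_comm` along maps of the indexing groups: the equivariance of the composite `T`-isomorphism with respect to the
composite `e₂ ∘ r ∘ e₁⁻¹` of the group maps. [cite: MochizukiAbsTopIII2015, Def 5.1 (vi) p.118] -/
theorem Iso.conj₃_comm_family {C : Type*} [Category C] {A' A B' B : C} (φ₁ : A' ≅ A) (ψ : A' ≅ B') (φ₂ : B' ≅ B)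
    {D₁' D₁ D₂' D₂ : Type*} (e₁ : D₁' ≃ D₁) (r : D₁' → D₂') (e₂ : D₂' → D₂)
    (a' : D₁' → (A' ⟶ A')) (a : D₁ → (A ⟶ A)) (b' : D₂' → (B' ⟶ B')) (b : D₂ → (B ⟶ B))
    (h1 : ∀ g, a' g ≫ φ₁.hom = φ₁.hom ≫ a (e₁ g)) (h2 : ∀ g, a' g ≫ ψ.hom = ψ.hom ≫ b' (r g))
    (h3 : ∀ h, b' h ≫ φ₂.hom = φ₂.hom ≫ b (e₂ h)) (g : D₁) :
    a g ≫ (φ₁.symm ≪≫ ψ ≪≫ φ₂).hom = (φ₁.symm ≪≫ ψ ≪≫ φ₂).hom ≫ b (e₂ (r (e₁.symm g))) := by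
  obtain ⟨g', rfl⟩ := e₁.surjective g
  rw [Equiv.symm_apply_apply]
  exact Iso.conj₃_comm φ₁ ψ φ₂ (h1 g') (h2 g') (h3 (r g'))

end Generic

namespace NumberFieldShadow

variable (F : Type) [Field F] [NumberField F]

/-! ### Kummer structures: transport along a composite of three isomorphisms -/

/-- Transport of a Kummer embedding along `x₁⁻¹ ≫ x_φ ≫ x₂` and `φ₁⁻¹ ≫ φ ≫ φ₂` (Def 4.1 (i): Kummer structures are carried by
isomorphisms of Aut-holomorphic pairs), in terms of the transports along `(x₁, φ₁)`, `(x_φ, φ)`, `(x₂, φ₂)`.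
[cite: MochizukiAbsTopIII2015, Def 4.1 (i) p.101] -/
theorem kummerTransportTF_conj₃ {Y₁ X₁ Y₂ X₂ : AutHolOrbispace.{0}} {B₁ A₁ B₂ A₂ : CommRingCat.{0}}
    (x₁ : AutHolOrbispace.Iso Y₁ X₁) (xφ : AutHolOrbispace.Iso Y₁ Y₂) (x₂ : AutHolOrbispace.Iso Y₂ X₂)
    (φ₁ : B₁ ≅ A₁) (φ : B₁ ≅ B₂) (φ₂ : B₂ ≅ A₂) (κ : B₁ →+* Y₁.fieldA) :
    kummerTransportTF ⟨x₁.toHomeomorph.symm.trans (xφ.toHomeomorph.trans x₂.toHomeomorph),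
        x₁.fieldIso.symm.trans (xφ.fieldIso.trans x₂.fieldIso), x₁.pi1Iso.symm.trans (xφ.pi1Iso.trans x₂.pi1Iso)⟩
      (φ₁.symm ≪≫ φ ≪≫ φ₂) (kummerTransportTF x₁ φ₁ κ) = kummerTransportTF x₂ φ₂ (kummerTransportTF xφ φ κ) := by
  refine RingHom.ext fun n => ?_
  simp only [kummerTransportTF_apply]
  change x₂.fieldIso (xφ.fieldIso (x₁.fieldIso.symm (x₁.fieldIso (κ (φ₁.inv.hom (φ₁.hom.hom (φ.inv.hom (φ₂.inv.hom n)))))))) =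
    x₂.fieldIso (xφ.fieldIso (κ (φ.inv.hom (φ₂.inv.hom n))))
  rw [RingEquiv.symm_apply_apply, iso_inv_hom_apply φ₁]

/-- `kummerTransportTF_conj₃` in equational form: the three transport equations of the panalocalization relations and of `φ`
assemble to the transport equation of the composite. [cite: MochizukiAbsTopIII2015, Def 4.1 (i) p.101] -/
theorem kummerTransportTF_conj₃_of_eq {Y₁ X₁ Y₂ X₂ : AutHolOrbispace.{0}} {B₁ A₁ B₂ A₂ : CommRingCat.{0}}
    (x₁ : AutHolOrbispace.Iso Y₁ X₁) (xφ : AutHolOrbispace.Iso Y₁ Y₂) (x₂ : AutHolOrbispace.Iso Y₂ X₂)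
    (φ₁ : B₁ ≅ A₁) (φ : B₁ ≅ B₂) (φ₂ : B₂ ≅ A₂) {κ : B₁ →+* Y₁.fieldA} {κ₁ : A₁ →+* X₁.fieldA}
    {κφ : B₂ →+* Y₂.fieldA} {κ₂ : A₂ →+* X₂.fieldA} (k₁ : kummerTransportTF x₁ φ₁ κ = κ₁)
    (kφ : kummerTransportTF xφ φ κ = κφ) (k₂ : kummerTransportTF x₂ φ₂ κφ = κ₂) :
    kummerTransportTF ⟨x₁.toHomeomorph.symm.trans (xφ.toHomeomorph.trans x₂.toHomeomorph),
        x₁.fieldIso.symm.trans (xφ.fieldIso.trans x₂.fieldIso), x₁.pi1Iso.symm.trans (xφ.pi1Iso.trans x₂.pi1Iso)⟩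
      (φ₁.symm ≪≫ φ ≪≫ φ₂) κ₁ = κ₂ := by
  rw [← k₁, kummerTransportTF_conj₃, kφ, k₂]

/-! ### The bijection of classes `V✠₁ ≅ V✠₂` induced by `V⊚(φ_Π)` -/

/-- **`V⊚(φ_Π)` descends, along the reference bijections `ψ₁ : V⊚(Π₁)/Aut(Π₁) ≅ V✠₁`, `ψ₂`, to a bijection `V✠₁ ≅ V✠₂` respecting
`⊚ / non / arc`**, with the defining formula `Φ(ψ₁[ṽ]) = ψ₂[V⊚(φ_Π)(ṽ)]` (abc-iut-L4-d2 g6's `exists_modAut_equiv` + the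
reference conditions (a) of Def 5.1 (iv)). [cite: MochizukiAbsTopIII2015, Def 5.1 (iv) p.116] -/
theorem exists_classEquiv {E₁ E₂ : FundamentalExtension.{0}} (h₁ : IsAdmissible F E₁) (h₂ : IsAdmissible F E₂)
    (f : E₁ ⟶ E₂) (hf : IsEAHom f) (T₁ T₂ : PanalocalGaloisTheater (context F))
    (ψ₁ : (context F).ProValModAut E₁ ≃ T₁.V) (ψ₂ : (context F).ProValModAut E₂ ≃ T₂.V)
    (href₁ : IsPanalocalReferenceFor (context F) T₁.generic T₁.non T₁.arc T₁.grp T₁.X E₁ ψ₁)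
    (href₂ : IsPanalocalReferenceFor (context F) T₂.generic T₂.non T₂.arc T₂.grp T₂.X E₂ ψ₂) :
    ∃ Φ : T₁.V ≃ T₂.V, Φ T₁.generic = T₂.generic ∧ Φ '' T₁.non = T₂.non ∧ Φ '' T₁.arc = T₂.arc ∧
      ∀ (vl : ((context F).proVal E₁).carrier) (c : T₁.V), ψ₁ ((context F).toModAut E₁ vl) = c →
        Φ c = ψ₂ ((context F).toModAut E₂ ((context F).mapProVal f hf vl)) := by
  letI := (NumberField.valuationProSet ℚ).action
  obtain ⟨β, hβ⟩ := exists_modAut_equiv F h₁ h₂ f hf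
  let Φ : T₁.V ≃ T₂.V := ψ₁.symm.trans (β.trans ψ₂)
  have hΦ : ∀ (vl : ((context F).proVal E₁).carrier) (c : T₁.V), ψ₁ ((context F).toModAut E₁ vl) = c →
      Φ c = ψ₂ ((context F).toModAut E₂ ((context F).mapProVal f hf vl)) := by
    intro vl c h
    subst h
    change ψ₂ (β (ψ₁.symm (ψ₁ ((context F).toModAut E₁ vl)))) = _
    rw [Equiv.symm_apply_apply, hβ]
  obtain ⟨hg₁, hn₁, ha₁, hl₁, hla₁⟩ := href₁
  obtain ⟨hg₂, hn₂, ha₂, hl₂, hla₂⟩ := href₂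
  let τ : absoluteGaloisGroup ℚ := conjugator f hf
  -- inverse images of lifts: `V⊚(φ_Π)(τ⁻¹ • w) = w`
  have hback : ∀ w : ((context F).proVal E₂).carrier,
      (context F).mapProVal f hf (show ((context F).proVal E₁).carrier from
        τ⁻¹ • (show (NumberField.valuationProSet ℚ).carrier from w)) = w := fun w => by
    change τ • τ⁻¹ • (show (NumberField.valuationProSet ℚ).carrier from w) = w
    rw [smul_inv_smul]
  have hgen : (context F).mapProVal f hf ((context F).proVal E₁).generic = ((context F).proVal E₂).generic :=
    contextMapProVal_generic f hf
  refine ⟨Φ, ?_, ?_, ?_, hΦ⟩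
  · rw [hΦ ((context F).proVal E₁).generic T₁.generic hg₁, hgen]
    exact hg₂
  · ext c₂
    constructor
    · rintro ⟨c, hc, rfl⟩
      obtain ⟨vl, hvl, hcl, -⟩ := hl₁ ⟨c, hc⟩
      rw [hΦ vl c hcl]
      exact hn₂ _ (contextMapProVal_mem_non f hf vl hvl)
    · intro hc₂
      obtain ⟨w, hw, hwc, -⟩ := hl₂ ⟨c₂, hc₂⟩
      have hvn : (show ((context F).proVal E₁).carrier from τ⁻¹ • (show (NumberField.valuationProSet ℚ).carrier from w)) ∈
          ((context F).proVal E₁).non := (NumberField.valuationProSet ℚ).smul_mem_non τ⁻¹ hw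
      refine ⟨ψ₁ ((context F).toModAut E₁ _), hn₁ _ hvn, ?_⟩
      rw [hΦ _ _ rfl, hback]
      exact hwc
  · ext c₂
    constructor
    · rintro ⟨c, hc, rfl⟩
      obtain ⟨vl, hcl, -⟩ := hla₁ ⟨c, hc⟩
      rw [hΦ vl.1 c hcl]
      exact ha₂ _ (contextMapProVal_mem_arc f hf vl.1 vl.2)
    · intro hc₂
      obtain ⟨w, hwc, -⟩ := hla₂ ⟨c₂, hc₂⟩
      have hva : (show ((context F).proVal E₁).carrier from τ⁻¹ • (show (NumberField.valuationProSet ℚ).carrier from w.1)) ∈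
          ((context F).proVal E₁).arc := (NumberField.valuationProSet ℚ).smul_mem_arc τ⁻¹ w.2
      refine ⟨ψ₁ ((context F).toModAut E₁ _), ha₁ _ hva, ?_⟩
      rw [hΦ _ _ rfl, hback]
      exact hwc

/-! ### F-3086 at every `TF`-shadow vocabulary -/

/-- **Def 5.1 (vi) / Cor 5.2 (vi), morphism part (F-3086 `PanalocalTPairMapsHom`), PROVED at every `TF`-shadow vocabulary over
`NumberFieldShadow.context F`**: a morphism `φ : M⊚₁ → M⊚₂` of global `TF`-pairs induces a morphism `{M⊚₁}✠ → {M⊚₂}✠` between ANY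
panalocalizations — on classes the descent of `V⊚(φ_Π)`; at each class the `T`-isomorphism / open injection / orbispace
isomorphism obtained by conjugating `φ_ṽ` (at a chosen lift `ṽ`) with the identifications of the two panalocalization relations,
the target one taken at the lift `V⊚(φ_Π)(ṽ)` of the image class thanks to `φ_V(ψ_{V,1} ṽ) = ψ_{V,2}(V⊚(φ_Π) ṽ)` (Rmk 5.1.1).
The MLF-Galois-pair predicate `P` and the Aut-holomorphic-pair predicate `P'` are never read.
[cite: MochizukiAbsTopIII2015, Cor 5.2 (vi) p.120] -/
theorem panalocalTPairMapsHom_fieldShadowWith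
    (P : ∀ {D : ProfiniteGrp.{0}} {M : CommRingCat.{0}}, (D →* Aut M) → Prop)
    (P' : ∀ {X : AutHolOrbispace.{0}} {M : CommRingCat.{0}}, ((M : Type) →+* X.fieldA) → Prop) :
    PanalocalTPairMapsHom ({ fieldShadowVocabulary F with
        IsMLFGaloisPair := fun {_} {_} act => P act, IsAutHolPair := fun {_} {_} κ => P' κ } :
      TPairVocabulary (context F) .TF) := by
  intro M₁ M₂ Q₁ Q₂ hQ₁ hQ₂ φ
  obtain ⟨ψV₁, hψV₁, ψ₁, href₁, hN₁, hA₁⟩ := hQ₁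
  obtain ⟨ψV₂, hψV₂, ψ₂, href₂, hN₂, hA₂⟩ := hQ₂
  have h₁ : IsAdmissible F M₁.theater.ext := M₁.theater.isAdmissible
  have h₂ : IsAdmissible F M₂.theater.ext := M₂.theater.isAdmissible
  -- the bijection of classes and the formula `φ_V ∘ ψ_{V,1} = ψ_{V,2} ∘ V⊚(φ_Π)`
  obtain ⟨Φ, hΦgen, hΦnon, hΦarc, hΦ⟩ := exists_classEquiv F h₁ h₂ φ.φV.φgrp φ.φV.isEAHom Q₁.theater Q₂.theater
    ψ₁ ψ₂ href₁ href₂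
  have hcompat : ∀ v, φ.φV.φV (ψV₁ v) = ψV₂ ((context F).mapProVal φ.φV.φgrp φ.φV.isEAHom v) :=
    fun v => theaterHom_phiV_apply_eq F φ.φV ψV₁ hψV₁ ψV₂ hψV₂ v
  have hΦnon_mem : ∀ c : Q₁.theater.non, Φ c ∈ Q₂.theater.non := fun c => by
    rw [← hΦnon]; exact ⟨c, c.2, rfl⟩
  have hΦarc_mem : ∀ c : Q₁.theater.arc, Φ c ∈ Q₂.theater.arc := fun c => by
    rw [← hΦarc]; exact ⟨c, c.2, rfl⟩
  have hnon_of₁ : ∀ {u : ((context F).proVal M₁.theater.ext).carrier}, u ∈ ((context F).proVal M₁.theater.ext).non →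
      ψV₁ u ∈ M₁.theater.V.non := fun {u} hu => by rw [← hψV₁.2.2.1]; exact ⟨u, hu, rfl⟩
  have harc_of₁ : ∀ {u : ((context F).proVal M₁.theater.ext).carrier}, u ∈ ((context F).proVal M₁.theater.ext).arc →
      ψV₁ u ∈ M₁.theater.V.arc := fun {u} hu => by rw [← hψV₁.2.2.2.1]; exact ⟨u, hu, rfl⟩
  /- (1) NONARCHIMEDEAN CLASSES: lifts, the source identification, the decomposition map, the target identification -/
  have pkg₁ : ∀ c : Q₁.theater.non, ∃ (vl : ((context F).proVal M₁.theater.ext).carrier)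
      (hvl : ψV₁ vl ∈ M₁.theater.V.non) (_ : ψ₁ ((context F).toModAut M₁.theater.ext vl) = c.1)
      (e : M₁.theater.V.decompGrp (ψV₁ vl) ≃ₜ* Q₁.theater.grp c) (φ₁ : M₁.Mnon ⟨ψV₁ vl, hvl⟩ ≅ Q₁.data.Mnon c),
      ∀ g, (M₁.actNon ⟨ψV₁ vl, hvl⟩ g).hom ≫ φ₁.hom = φ₁.hom ≫ (Q₁.data.actNon c (e g)).hom := by
    intro c
    obtain ⟨vl, hvn, hcl, -⟩ := href₁.2.2.2.1 c
    obtain ⟨e, φ₁, he⟩ := Q₁.nonarch_at M₁ ψV₁ ψ₁ hN₁ vl (ψV₁ vl) (hnon_of₁ hvn) rfl c.1 c.2 hcl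
    exact ⟨vl, hnon_of₁ hvn, hcl, e, φ₁, he⟩
  choose vl hvl hvlc e₁ φ₁ he₁ using pkg₁
  have hb : ∀ c : Q₁.theater.non, φ.φV.φV (ψV₁ (vl c)) ∈ M₂.theater.V.non := fun c => φ.non_mem ⟨_, hvl c⟩
  have pkgr : ∀ c : Q₁.theater.non, ∃ r : M₁.theater.V.decompGrp (ψV₁ (vl c)) →ₜ*
      M₂.theater.V.decompGrp (φ.φV.φV (ψV₁ (vl c))), IsOpenInjection r ∧ ∀ g, (r g).1 = φ.φV.φgrp.arith g.1 :=
    fun c => φ.φV.exists_decompGrpHom (ψV₁ (vl c))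
  choose r hr hr₁ using pkgr
  have pkg₂ : ∀ c : Q₁.theater.non, ∃ (e : M₂.theater.V.decompGrp (φ.φV.φV (ψV₁ (vl c))) ≃ₜ*
      Q₂.theater.grp ⟨Φ c, hΦnon_mem c⟩) (φ₂ : M₂.Mnon ⟨_, hb c⟩ ≅ Q₂.data.Mnon ⟨Φ c, hΦnon_mem c⟩),
      ∀ g, (M₂.actNon ⟨_, hb c⟩ g).hom ≫ φ₂.hom = φ₂.hom ≫ (Q₂.data.actNon ⟨Φ c, hΦnon_mem c⟩ (e g)).hom :=
    fun c => Q₂.nonarch_at M₂ ψV₂ ψ₂ hN₂ _ _ (hb c) (hcompat (vl c)).symm _ (hΦnon_mem c) (hΦ (vl c) c (hvlc c)).symm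
  choose e₂ φ₂ he₂ using pkg₂
  /- (2) ARCHIMEDEAN CLASSES: likewise with orbispaces and Kummer structures -/
  have pkg₁a : ∀ c : Q₁.theater.arc, ∃ (vl : ((context F).proVal M₁.theater.ext).carrier)
      (hvl : ψV₁ vl ∈ M₁.theater.V.arc) (_ : ψ₁ ((context F).toModAut M₁.theater.ext vl) = c.1)
      (x : AutHolOrbispace.Iso (M₁.theater.X ⟨ψV₁ vl, hvl⟩) (Q₁.theater.X c)) (φ₁ : M₁.Marc ⟨ψV₁ vl, hvl⟩ ≅ Q₁.data.Marc c),
      ({ fieldShadowVocabulary F with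
          IsMLFGaloisPair := fun {_} {_} act => P act, IsAutHolPair := fun {_} {_} κ => P' κ } :
        TPairVocabulary (context F) .TF).kummerTransport x φ₁ (M₁.kummer ⟨ψV₁ vl, hvl⟩) = Q₁.data.kummer c := by
    intro c
    obtain ⟨vl, hcl, -⟩ := href₁.2.2.2.2 c
    obtain ⟨x, φ₁, hk⟩ := Q₁.arch_at M₁ ψV₁ ψ₁ hA₁ vl.1 (ψV₁ vl.1) (harc_of₁ vl.2) rfl c.1 c.2 hcl
    exact ⟨vl.1, harc_of₁ vl.2, hcl, x, φ₁, hk⟩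
  choose vla hvla hvlac x₁ φ₁a hk₁ using pkg₁a
  have hba : ∀ c : Q₁.theater.arc, φ.φV.φV (ψV₁ (vla c)) ∈ M₂.theater.V.arc := fun c => φ.arc_mem ⟨_, hvla c⟩
  have pkgφ : ∀ c : Q₁.theater.arc, ∃ xφ : AutHolOrbispace.Iso (M₁.theater.X ⟨ψV₁ (vla c), hvla c⟩)
      (M₂.theater.X ⟨φ.φV.φV (ψV₁ (vla c)), hba c⟩),
      ({ fieldShadowVocabulary F with
          IsMLFGaloisPair := fun {_} {_} act => P act, IsAutHolPair := fun {_} {_} κ => P' κ } :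
        TPairVocabulary (context F) .TF).kummerTransport xφ (φ.φarc ⟨_, hvla c⟩) (M₁.kummer ⟨ψV₁ (vla c), hvla c⟩) =
        M₂.kummer ⟨φ.φV.φV (ψV₁ (vla c)), hba c⟩ := fun c => by
    obtain ⟨xφ, -, -, hk⟩ := φ.φarc_kummer ⟨_, hvla c⟩
    exact ⟨xφ, hk⟩
  choose xφ hkφ using pkgφ
  have pkg₂a : ∀ c : Q₁.theater.arc, ∃ (x : AutHolOrbispace.Iso (M₂.theater.X ⟨_, hba c⟩)
      (Q₂.theater.X ⟨Φ c, hΦarc_mem c⟩)) (φ₂ : M₂.Marc ⟨_, hba c⟩ ≅ Q₂.data.Marc ⟨Φ c, hΦarc_mem c⟩),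
      ({ fieldShadowVocabulary F with
          IsMLFGaloisPair := fun {_} {_} act => P act, IsAutHolPair := fun {_} {_} κ => P' κ } :
        TPairVocabulary (context F) .TF).kummerTransport x φ₂ (M₂.kummer ⟨_, hba c⟩) =
        Q₂.data.kummer ⟨Φ c, hΦarc_mem c⟩ :=
    fun c => Q₂.arch_at M₂ ψV₂ ψ₂ hA₂ _ _ (hba c) (hcompat (vla c)).symm _ (hΦarc_mem c) (hΦ (vla c) c (hvlac c)).symm
  choose x₂ φ₂a hk₂ using pkg₂a
  /- (3) THE MORPHISM `{φ}✠` -/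
  have hφn : ∀ (c : Q₁.theater.non) (g' : M₁.theater.V.decompGrp (ψV₁ (vl c))),
      (M₁.actNon ⟨ψV₁ (vl c), hvl c⟩ g').hom ≫ (φ.φnon ⟨_, hvl c⟩).hom =
        (φ.φnon ⟨_, hvl c⟩).hom ≫ (M₂.actNon ⟨_, hb c⟩ (r c g')).hom := by
    intro c g'
    have hg' : φ.φV.φgrp.arith g'.1 ∈ M₂.theater.V.decomp (φ.φV.φV (ψV₁ (vl c))) := by
      rw [← hr₁ c g']; exact (r c g').2
    have hrg : r c g' = ⟨φ.φV.φgrp.arith g'.1, hg'⟩ := Subtype.ext (hr₁ c g')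
    rw [hrg]
    exact φ.φnon_equivariant ⟨_, hvl c⟩ g'.1 g'.2 hg'
  exact ⟨{ φV :=
             { φV := Φ
               φV_generic := hΦgen
               image_non := hΦnon
               image_arc := hΦarc
               non_mem := hΦnon_mem
               arc_mem := hΦarc_mem
               grpHom := fun c => (e₂ c : _ →ₜ* _).comp ((r c).comp ((e₁ c).symm : _ →ₜ* _))
               grpHom_isOpenInjection := fun c => IsOpenInjection.equiv_comp_comp_equiv (e₁ c) (r c) (hr c) (e₂ c)
               archIso := fun c =>
                 ⟨(x₁ c).toHomeomorph.symm.trans ((xφ c).toHomeomorph.trans (x₂ c).toHomeomorph),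
                   (x₁ c).fieldIso.symm.trans ((xφ c).fieldIso.trans (x₂ c).fieldIso),
                   (x₁ c).pi1Iso.symm.trans ((xφ c).pi1Iso.trans (x₂ c).pi1Iso)⟩ }
           φnon := fun c => (φ₁ c).symm ≪≫ φ.φnon ⟨_, hvl c⟩ ≪≫ φ₂ c
           φnon_equivariant := fun c g => Iso.conj₃_comm_family (φ₁ c) (φ.φnon ⟨_, hvl c⟩) (φ₂ c)
             (e₁ c).toEquiv (r c) (e₂ c) (fun g' => (M₁.actNon ⟨ψV₁ (vl c), hvl c⟩ g').hom)
             (fun g => (Q₁.data.actNon c g).hom) (fun h => (M₂.actNon ⟨_, hb c⟩ h).hom)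
             (fun h => (Q₂.data.actNon ⟨Φ c, hΦnon_mem c⟩ h).hom) (he₁ c) (hφn c) (he₂ c) g
           φarc := fun c => (φ₁a c).symm ≪≫ φ.φarc ⟨_, hvla c⟩ ≪≫ φ₂a c
           φarc_kummer := fun c => kummerTransportTF_conj₃_of_eq (x₁ c) (xφ c) (x₂ c) (φ₁a c) (φ.φarc ⟨_, hvla c⟩)
             (φ₂a c) (hk₁ c) (hkφ c) (hk₂ c) }⟩

/-! ### Corollaries: the two `TF`-shadow vocabularies of record -/

/-- **F-3086 at the `TF`-shadow vocabulary `fieldShadowVocabulary F`** (p491073). [cite: MochizukiAbsTopIII2015, Cor 5.2 (vi) p.120] -/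
theorem panalocalTPairMapsHom_fieldShadow : PanalocalTPairMapsHom (fieldShadowVocabulary F) :=
  panalocalTPairMapsHom_fieldShadowWith F (fun {D} {_} _ => IsMLFGaloisType D) (fun {_} {_} κ => Function.Injective κ)

/-- **F-3086 at the `TF`-shadow vocabulary `fieldShadowVocabulary' F`** (p493095, print-shape MLF-pair predicate).
[cite: MochizukiAbsTopIII2015, Cor 5.2 (vi) p.120] -/
theorem panalocalTPairMapsHom_fieldShadow' : PanalocalTPairMapsHom (fieldShadowVocabulary' F) :=
  panalocalTPairMapsHom_fieldShadowWith F (fun {_} {_} act => IsShadowMLFGaloisTFPair act)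
    (fun {_} {_} κ => Function.Injective κ)

end NumberFieldShadow

end Literature.AnabelianGeometry.AbsoluteAnabelian

end
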